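import Literature.MathematicalPhysics.QuantumFieldTheory.Balaban1983to89.B1RTSemigroup
import Literature.MathematicalPhysics.QuantumFieldTheory.Balaban1983to89.HiggsAveragingCompose

/-!
# `Balaban1983to89.B1Eq214Concrete` — T. Bałaban, *(Higgs)₂,₃ quantum fields in a finite volume. I. A lower bound*, Commun. Math. Phys. **85** (1982) 603–626 [Balaban1982Higgs1]: the semigroup law (2.14) `T^{L^kε}_{a,L,A} T^ε_{a_k,L^k,A} = T^ε_{a_{k+1},L^{k+1},A}` and the composition law (2.16) PROVED for the concrete lattice model

statement-level skeleton of published theorems with citation tags; proofs where landed; nothing here is a claim about the Yang–Mills mass gap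

PDF held: `paper:balaban1982-cmp85-higgs23-i` (journal page = PDF page + 602); pp. 608–609 [PDF 6–7] read from the
×2 renders of the cell `pub-balaban`.

CITATION HEADER — WHAT IS REPRODUCED.  KNITTING for SKELETON row **B1.Eq2.14** (the abstract operator identity is
`…B1RTSemigroup.display214`, p242870): the printed identity for the typer's CONCRETE transformations
`…HiggsAveraging.renormTransf` (T^{L^kε}_{a,L,A}, (2.4)–(2.7), case Ω = T^{(k)}) and `…HiggsAveraging.renormTransfK`
(T^ε_{a_k,L^k,A}, (2.10)–(2.11)) on the tori `HiggsLattice.Site P k` of (1.2)/(1.19): p. 609 [PDF 7], verbatim — *"From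
this formula we obtain T^{L^kε}_{a,L,A}T^ε_{a_k,L^k,A} = T^ε_{a_{k+1},L^{k+1},A}. (2.14)"* — as `renormTransf_renormTransfK`,
for 1 ≤ k < K (the level range in which the block map of (1.17) is the honest integer division, `HiggsLattice.blockOf`),
a > 0, L > 1 and integrable densities ρ(A,·).  Route: the block parametrisation T^{(k)} ≃ T^{(k+1)} × {0,…,L−1}^d
(`siteEquiv`; the arithmetic of `TorusGeometry.blockEquiv` redone for the per-direction sizes of `HiggsLattice`), the
transport of the field integrals along it (`MeasureTheory.volume_measurePreserving_piCongrLeft`), `B1RTSemigroup.display214`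
with |B| = L^d, the composition rule Q(A)Q_k(A) = Q_{k+1}(A) (`HiggsAveragingCompose.avgQ_avgQk`, p243320) and the
precision bookkeeping a_{k+1}(L^{k+1}ε)^{d−2} (`B1RT.prec_comp`, `B1.aSeq_succ`).  And, by induction on k, row
**B1.Eq2.16** for the model: *"T^{L^{k−1}ε}_{a,L,A} … T^{Lε}_{a,L,A}T^ε_{a,L,A} = T^ε_{a_k,L^k,A}. (2.16)"* as
`renormChain_eq_renormTransfK` (`renormChain` = the one-step transformation iterated k times; 1 ≤ k ≤ K; the base
case is a_1 = a, `B1.aSeq_one`, and Q_1(A) = Q(A), `avgQk_one`).  Nothing else; unit `lit-balaban-r14` (gen 2), HOME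
`run/shared/lean/pub/lit-balaban/`.
-/

open scoped BigOperators

namespace Literature.MathematicalPhysics.QuantumFieldTheory.Balaban1983to89.B1Eq214Concrete

open _root_.MeasureTheory HiggsLattice HiggsAveraging B1RT B1RTSemigroup

variable {P : Params}

/-! ## 1. Block arithmetic on `HiggsLattice.Site` in the range k < K -/

section Blocks

variable {k : ℕ}

/-- `sitesPerDir k μ = sitesPerDir (k+1) μ · L` for k < K ((1.2)/(1.19): ε⁻¹L_μ = L^K M L'_μ). [cite: Balaban1982Higgs1, (1.19) p.607] -/
theorem sitesPerDir_eq_mul_succ (hk : k < P.K) (μ : Fin P.d) :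
    P.sitesPerDir k μ = P.sitesPerDir (k + 1) μ * P.L := by
  unfold Params.sitesPerDir
  have h : P.K - k = (P.K - (k + 1)) + 1 := by omega
  rw [h, pow_succ]
  ring

/-- The label of `blockOf x` is the integer quotient of the label of x by L (no wrap-around for k < K).
[cite: Balaban1982Higgs1, (1.17) p.606] -/
theorem val_blockOf (hk : k < P.K) (x : Site P k) (μ : Fin P.d) :
    ((blockOf x) μ).val = (x μ).val / P.L := by
  simp only [blockOf]
  rw [ZMod.val_natCast, Nat.mod_eq_of_lt]
  rw [Nat.div_lt_iff_lt_mul P.hL, ← sitesPerDir_eq_mul_succ hk]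
  exact ZMod.val_lt (x μ)

/-- The fine site of the block `B(y)` at position `r ∈ {0,…,L−1}^d` ((1.17): x_μ = Ly_μ + r_μ in labels). [cite: Balaban1982Higgs1, (1.17) p.606] -/
def blockSite (y : Site P (k + 1)) (r : Fin P.d → Fin P.L) : Site P k :=
  fun μ => (((y μ).val * P.L + r μ : ℕ) : ZMod (P.sitesPerDir k μ))

/-- Label of `blockSite y r` is `L·y + r`. [cite: Balaban1982Higgs1, (1.17) p.606] -/
theorem val_blockSite (hk : k < P.K) (y : Site P (k + 1)) (r : Fin P.d → Fin P.L) (μ : Fin P.d) :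
    ((blockSite y r) μ).val = (y μ).val * P.L + r μ := by
  simp only [blockSite]
  rw [ZMod.val_natCast, Nat.mod_eq_of_lt]
  have hy : (y μ).val + 1 ≤ P.sitesPerDir (k + 1) μ := ZMod.val_lt (y μ)
  have h1 : ((y μ).val + 1) * P.L ≤ P.sitesPerDir (k + 1) μ * P.L := Nat.mul_le_mul_right _ hy
  have h2 := (r μ).isLt
  rw [sitesPerDir_eq_mul_succ hk]
  rw [Nat.add_mul, one_mul] at h1
  omega

/-- `blockSite y r ∈ B(y)`. [cite: Balaban1982Higgs1, (1.17) p.606] -/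
theorem blockOf_blockSite (hk : k < P.K) (y : Site P (k + 1)) (r : Fin P.d → Fin P.L) :
    blockOf (blockSite y r) = y := by
  funext μ
  apply ZMod.val_injective
  rw [val_blockOf hk, val_blockSite hk, mul_comm, Nat.mul_add_div P.hL, Nat.div_eq_of_lt (r μ).isLt, add_zero]

/-- The position of a fine site inside its block: r_μ = x_μ mod L. [cite: Balaban1982Higgs1, (1.17) p.606] -/
def posInBlock (x : Site P k) : Fin P.d → Fin P.L := fun μ => ⟨(x μ).val % P.L, Nat.mod_lt _ P.hL⟩

/-- `posInBlock (blockSite y r) = r`. [cite: Balaban1982Higgs1, (1.17) p.606] -/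
theorem posInBlock_blockSite (hk : k < P.K) (y : Site P (k + 1)) (r : Fin P.d → Fin P.L) :
    posInBlock (blockSite y r) = r := by
  funext μ
  apply Fin.ext
  show ((blockSite y r) μ).val % P.L = (r μ : ℕ)
  rw [val_blockSite hk, Nat.mul_add_mod', Nat.mod_eq_of_lt (r μ).isLt]

/-- A fine site is the site of its block at its position: x = blockSite (blockOf x) (posInBlock x).
[cite: Balaban1982Higgs1, (1.17) p.606] -/
theorem blockSite_blockOf_posInBlock (hk : k < P.K) (x : Site P k) :
    blockSite (blockOf x) (posInBlock x) = x := by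
  funext μ
  apply ZMod.val_injective
  rw [val_blockSite hk, val_blockOf hk]
  show (x μ).val / P.L * P.L + (x μ).val % P.L = (x μ).val
  have h := Nat.div_add_mod ((x μ).val) P.L
  rw [mul_comm]
  exact h

/-- **The block parametrisation** T^{(k)} ≃ T^{(k+1)} × {0,…,L−1}^d, x ↦ (its block, its position), for k < K: the
middle lattice of (2.14) IS the product `Z × B` of `B1RTSemigroup.Display214` with |B| = L^d.
[cite: Balaban1982Higgs1, (1.17)–(1.19) pp.606–607] -/
def siteEquiv (hk : k < P.K) : Site P k ≃ Site P (k + 1) × (Fin P.d → Fin P.L) where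
  toFun x := (blockOf x, posInBlock x)
  invFun p := blockSite p.1 p.2
  left_inv x := blockSite_blockOf_posInBlock hk x
  right_inv p := by
    ext1
    · exact blockOf_blockSite hk p.1 p.2
    · exact posInBlock_blockSite hk p.1 p.2

/-- Unfolding lemma. [cite: Balaban1982Higgs1, (1.17) p.606] -/
theorem siteEquiv_apply (hk : k < P.K) (x : Site P k) : siteEquiv hk x = (blockOf x, posInBlock x) := rfl

/-- Unfolding lemma. [cite: Balaban1982Higgs1, (1.17) p.606] -/
theorem siteEquiv_symm_apply (hk : k < P.K) (p : Site P (k + 1) × (Fin P.d → Fin P.L)) :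
    (siteEquiv hk).symm p = blockSite p.1 p.2 := rfl

/-- The block `B(z)` as the image of the positions: Σ_{x∈B(z)} F(x) = Σ_r F(blockSite z r). [cite: Balaban1982Higgs1, (1.17) p.606] -/
theorem sum_block_eq_sum_blockSite (hk : k < P.K) {M : Type*} [AddCommMonoid M] (z : Site P (k + 1)) (F : Site P k → M) :
    ∑ x ∈ block z, F x = ∑ r : Fin P.d → Fin P.L, F (blockSite z r) := by
  have himage : block z = Finset.univ.image (blockSite z) := by
    ext x
    simp only [block, Finset.mem_filter, Finset.mem_univ, true_and, Finset.mem_image]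
    constructor
    · intro hx
      exact ⟨posInBlock x, by rw [← hx, blockSite_blockOf_posInBlock hk x]⟩
    · rintro ⟨r, rfl⟩
      exact blockOf_blockSite hk z r
  rw [himage, Finset.sum_image]
  intro r _ r' _ h
  rw [← posInBlock_blockSite hk z r, h, posInBlock_blockSite hk z r']

end Blocks

/-! ## 2. The concrete transformations as instances of the product model of `B1RTSemigroup` -/

section Transport

variable {N : ℕ} (C : ChargeData N) (A : VecField P 0) {k : ℕ}

/-- The transports U(A(Γ_{z,x})) of (2.7), indexed by (block, position) and packaged as isometric equivalences of R^N
(`HiggsLattice.ChargeData.U_mem_unitary` + Mathlib's `Unitary.linearIsometryEquiv`). [cite: Balaban1982Higgs1, (2.7) p.608] -/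
noncomputable def uQ (p : Site P (k + 1) × (Fin P.d → Fin P.L)) :
    EuclideanSpace ℝ (Fin N) ≃ₗᵢ[ℝ] EuclideanSpace ℝ (Fin N) :=
  Unitary.linearIsometryEquiv
    ⟨C.U (P.mesh 0) (contourSum A (toFinest p.1) (toFinest (blockSite p.1 p.2))), C.U_mem_unitary _ _⟩

/-- `uQ` acts as the transport `holQ` of (2.7). [cite: Balaban1982Higgs1, (2.7) p.608] -/
theorem uQ_apply (p : Site P (k + 1) × (Fin P.d → Fin P.L)) (v : EuclideanSpace ℝ (Fin N)) :
    uQ C A p v = holQ C A p.1 (blockSite p.1 p.2) v := rfl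

/-- The field transport along the block parametrisation: a field on T^{(k+1)} × positions IS a field on T^{(k)}.
[cite: Balaban1982Higgs1, (1.17) p.606] -/
noncomputable def fieldEquiv (hk : k < P.K) :
    (Site P (k + 1) × (Fin P.d → Fin P.L) → EuclideanSpace ℝ (Fin N)) ≃ᵐ ScalarField P k N :=
  MeasurableEquiv.piCongrLeft (fun _ : Site P k => EuclideanSpace ℝ (Fin N)) (siteEquiv hk).symm

/-- Evaluation of the transported field: `(fieldEquiv g)(x) = g(blockOf x, posInBlock x)`. [cite: Balaban1982Higgs1, (1.17) p.606] -/
theorem fieldEquiv_apply (hk : k < P.K) (g : Site P (k + 1) × (Fin P.d → Fin P.L) → EuclideanSpace ℝ (Fin N))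
    (x : Site P k) : fieldEquiv (N := N) hk g x = g (siteEquiv hk x) := by
  have hx : x = (siteEquiv hk).symm (siteEquiv hk x) := ((siteEquiv hk).symm_apply_apply x).symm
  conv_lhs => rw [hx]
  rw [fieldEquiv, MeasurableEquiv.coe_piCongrLeft, Equiv.piCongrLeft_apply_apply]

/-- `fieldEquiv` preserves the Lebesgue measures dφ (products over the sites). [cite: Balaban1982Higgs1, (2.4) p.608] -/
theorem measurePreserving_fieldEquiv (hk : k < P.K) :
    MeasurePreserving (fieldEquiv (N := N) hk) volume volume :=
  volume_measurePreserving_piCongrLeft (fun _ : Site P k => EuclideanSpace ℝ (Fin N)) (siteEquiv hk).symm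

/-- **Q(A) in block coordinates**: the average (2.7) of a transported field is `B1RTSemigroup.qAvg` with weight L^{−d} and
transports `uQ`. [cite: Balaban1982Higgs1, (2.7) p.608] -/
theorem avgQ_fieldEquiv (hk : k < P.K) (g : Site P (k + 1) × (Fin P.d → Fin P.L) → EuclideanSpace ℝ (Fin N))
    (z : Site P (k + 1)) :
    avgQ C A (fieldEquiv hk g) z = qAvg (((P.L : ℝ) ^ P.d)⁻¹) (uQ C A) g z := by
  rw [avgQ_apply, qAvg_apply, sum_block_eq_sum_blockSite hk]
  congr 1
  refine Finset.sum_congr rfl fun r _ => ?_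
  rw [fieldEquiv_apply, siteEquiv_apply, blockOf_blockSite hk, posInBlock_blockSite hk, uQ_apply]
  rfl

/-- The transported k-th order average: `m φ (z, r) = (Q_k(A)φ)(blockSite z r)`. [cite: Balaban1982Higgs1, (2.11) p.609] -/
noncomputable def mQk (k : ℕ) (φ : ScalarField P 0 N) (p : Site P (k + 1) × (Fin P.d → Fin P.L)) :
    EuclideanSpace ℝ (Fin N) :=
  avgQk C A k φ (blockSite p.1 p.2)

/-- `fieldEquiv (mQk φ) = Q_k(A)φ`. [cite: Balaban1982Higgs1, (2.11) p.609] -/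
theorem fieldEquiv_mQk (hk : k < P.K) (φ : ScalarField P 0 N) :
    fieldEquiv (N := N) hk (mQk C A k φ) = avgQk C A k φ := by
  funext x
  rw [fieldEquiv_apply, mQk, siteEquiv_apply]
  show avgQk C A k φ (blockSite (blockOf x) (posInBlock x)) = avgQk C A k φ x
  rw [blockSite_blockOf_posInBlock hk]

/-- `mQk` is continuous (linear) in the fine field. [cite: Balaban1982Higgs1, (2.11) p.609] -/
theorem continuous_mQk (k : ℕ) : Continuous (mQk (P := P) C A k) := by
  refine continuous_pi fun p => ?_
  show Continuous fun φ : ScalarField P 0 N => avgQk C A k φ (blockSite p.1 p.2)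
  simp only [avgQk_apply]
  exact (continuous_finsetSum _ fun x _ =>
    (C.U (P.mesh 0) (multiContourSum A k x)).continuous.comp (continuous_apply x)).const_smul
      (((P.L : ℝ) ^ (k * P.d))⁻¹)

/-- The one-step kernel (2.5)–(2.6) of the model, evaluated on a transported middle field, IS the product-model kernel
`B1RT.blockKernel α (qAvg L^{−d} uQ)`. [cite: Balaban1982Higgs1, (2.6) p.608] -/
theorem rtKernelStep_fieldEquiv (hk : k < P.K) (a : ℝ) (ψ : ScalarField P (k + 1) N)
    (g : Site P (k + 1) × (Fin P.d → Fin P.L) → EuclideanSpace ℝ (Fin N)) :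
    rtKernelStep C a A ψ (fieldEquiv hk g)
      = blockKernel (prec a (P.mesh (k + 1)) P.d) (qAvg (((P.L : ℝ) ^ P.d)⁻¹) (uQ C A)) ψ g := by
  simp only [rtKernelStep, blockKernel_eq, avgQ_fieldEquiv C A hk]

/-- The k-th order kernel (2.10) of the model with a transported middle field IS the product-model kernel
`B1RT.blockKernel β mQk`. [cite: Balaban1982Higgs1, (2.10) p.609] -/
theorem rtKernelK_fieldEquiv (hk : k < P.K) (a : ℝ) (g : Site P (k + 1) × (Fin P.d → Fin P.L) → EuclideanSpace ℝ (Fin N))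
    (φ : ScalarField P 0 N) :
    rtKernelK C a A k (fieldEquiv hk g) φ
      = blockKernel (prec (B1.aSeq a P.L k) (P.mesh k) P.d) (mQk C A k) g φ := by
  simp only [rtKernelK, blockKernel_eq]
  refine Fintype.prod_equiv (siteEquiv hk) _ _ fun x => ?_
  rw [fieldEquiv_apply, mQk]
  show rtKernel _ (g (siteEquiv hk x) - avgQk C A k φ x)
      = rtKernel _ (g (siteEquiv hk x) - avgQk C A k φ (blockSite (blockOf x) (posInBlock x)))
  rw [blockSite_blockOf_posInBlock hk]

end Transport

/-! ## 3. (2.14) for the model -/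

section Semigroup

variable {N : ℕ}

/-- The precision bookkeeping of (2.14) for the model's constants: composing a(L^{k+1}ε)^{d−2} (one step) with
a_k(L^kε)^{d−2} (k-th order) over blocks of L^d sites with weight L^{−d} gives a_{k+1}(L^{k+1}ε)^{d−2}
(`B1RT.prec_comp` + `B1.aSeq_succ`). [cite: Balaban1982Higgs1, (2.13) p.609] -/
theorem compPrec_model {a : ℝ} (ha : 0 < a) (hL : 1 < P.L) {k : ℕ} (hk : 1 ≤ k) :
    compPrec (prec a (P.mesh (k + 1)) P.d) (prec (B1.aSeq a P.L k) (P.mesh k) P.d) (((P.L : ℝ) ^ P.d)⁻¹)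
        (Fintype.card (Fin P.d → Fin P.L))
      = prec (B1.aSeq a P.L (k + 1)) (P.mesh (k + 1)) P.d := by
  have hL' : (1 : ℝ) < P.L := by exact_mod_cast hL
  have hmesh : P.mesh (k + 1) = P.L * P.mesh k := by
    simp only [Params.mesh, pow_succ]
    ring
  rw [Fintype.card_fun, Fintype.card_fin, Fintype.card_fin, hmesh,
    prec_comp ha (B1.aSeq_pos ha hL' hk) P.hL (P.mesh_pos k), aNext_eq_aSeq_succ ha hL' hk]

/-- **(2.14) for the concrete model**, KERNEL: for 1 ≤ k < K, a > 0, L > 1 and every integrable density ρ(A,·) of the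
ε-lattice fields, applying the k-th order transformation T^ε_{a_k,L^k,A} (`renormTransfK … k`) and then the one-step
transformation T^{L^kε}_{a,L,A} (`renormTransf`) gives the (k+1)-st order transformation T^ε_{a_{k+1},L^{k+1},A}
(`renormTransfK … (k+1)`) — verbatim p. 609: *"From this formula we obtain T^{L^kε}_{a,L,A}T^ε_{a_k,L^k,A} =
T^ε_{a_{k+1},L^{k+1},A}. (2.14)"*. [cite: Balaban1982Higgs1, (2.14) p.609] -/
theorem renormTransf_renormTransfK (C : ChargeData N) {a : ℝ} (ha : 0 < a) (hL : 1 < P.L) (A : VecField P 0)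
    {k : ℕ} (hk1 : 1 ≤ k) (hkK : k < P.K) {ρ : ScalarField P 0 N → ℝ} (hρ : Integrable ρ) :
    renormTransf C a A (renormTransfK C a A k ρ) = renormTransfK C a A (k + 1) ρ := by
  have hL' : (1 : ℝ) < P.L := by exact_mod_cast hL
  set α := prec a (P.mesh (k + 1)) P.d with hα
  set β := prec (B1.aSeq a P.L k) (P.mesh k) P.d with hβ
  set w : ℝ := ((P.L : ℝ) ^ P.d)⁻¹ with hw
  have hαpos : 0 < α := prec_pos ha (P.mesh_pos (k + 1)) P.d
  have hβpos : 0 < β := prec_pos (B1.aSeq_pos ha hL' hk1) (P.mesh_pos k) P.d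
  -- the abstract semigroup law for the product model
  have h214 := display214 (V := EuclideanSpace ℝ (Fin N)) hαpos hβpos w (uQ C A (k := k))
    (continuous_mQk C A k).measurable hρ
  rw [display214_iff] at h214
  funext ψ
  -- left side: transport the middle-field integral along `fieldEquiv`
  have hmp := measurePreserving_fieldEquiv (N := N) (P := P) hkK
  have hL1 : renormTransf C a A (renormTransfK C a A k ρ) ψ
      = ∫ g, blockKernel α (qAvg w (uQ C A)) ψ g *
          ∫ φ, blockKernel β (mQk C A k) g φ * ρ φ := by
    rw [renormTransf, rtOp_eq, ← hmp.integral_comp']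
    refine integral_congr_ae (Filter.Eventually.of_forall fun g => ?_)
    simp only [renormTransfK, rtOp_eq]
    rw [rtKernelStep_fieldEquiv C A hkK a ψ g]
    congr 1
    refine integral_congr_ae (Filter.Eventually.of_forall fun φ => ?_)
    dsimp only
    rw [rtKernelK_fieldEquiv C A hkK a g φ]
  -- right side: the (k+1)-st order kernel is the composed product-model kernel
  have hR : renormTransfK C a A (k + 1) ρ ψ
      = ∫ φ, blockKernel (compPrec α β w (Fintype.card (Fin P.d → Fin P.L)))
          (fun φ => qAvg w (uQ C A) (mQk C A k φ)) ψ φ * ρ φ := by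
    rw [renormTransfK, rtOp_eq]
    refine integral_congr_ae (Filter.Eventually.of_forall fun φ => ?_)
    dsimp only
    congr 1
    rw [hα, hβ, hw, compPrec_model ha hL hk1, rtKernelK, blockKernel_eq, blockKernel_eq]
    refine Finset.prod_congr rfl fun z _ => ?_
    rw [← avgQ_fieldEquiv C A hkK, fieldEquiv_mQk C A hkK, HiggsAveragingCompose.avgQ_avgQk]
  rw [hL1, hR]
  exact h214 ψ

end Semigroup

/-! ## 4. (2.16) for the model: k successive one-step transformations -/

section Chain

variable {N : ℕ} (C : ChargeData N) (a : ℝ) (A : VecField P 0)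

/-- The left side of (2.16) for the model: `T^{L^{k−1}ε}_{a,L,A} ⋯ T^{Lε}_{a,L,A} T^ε_{a,L,A}` = the one-step
transformation `HiggsAveraging.renormTransf` applied k times, from densities of the ε-lattice fields to densities on
T^{(k)}. [cite: Balaban1982Higgs1, (2.16) p.609] -/
noncomputable def renormChain : (k : ℕ) → (ScalarField P 0 N → ℝ) → ScalarField P k N → ℝ
  | 0, ρ => ρ
  | k + 1, ρ => renormTransf C a A (renormChain k ρ)

/-- `B^1(y) = B(y)` (the iterated block of order one). [cite: Balaban1982Higgs1, (1.20) p.607] -/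
theorem blockK_one (y : Site P 1) : blockK 1 y = block y := by
  ext x
  simp [mem_blockK, blockIter, block]

/-- `Q_1(A) = Q(A)` on the ε-lattice ((2.11) at k = 1 is (2.7): Γ^{(1)}_{y,x} = Γ_{y,x}, L^{−1·d} = L^{−d}).
[cite: Balaban1982Higgs1, (2.11) p.609] -/
theorem avgQk_one : avgQk C A 1 = avgQ (N := N) C A := by
  funext f y
  rw [avgQk_apply, avgQ_apply, blockK_one, one_mul]
  congr 1
  refine Finset.sum_congr rfl fun x hx => ?_
  have hx' : blockOf x = y := by simpa [block] using hx
  simp [multiContourSum, blockIter, hx']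

/-- `T^ε_{a_1,L,A} = T^ε_{a,L,A}` for the model (a_1 = a, (2.15); `B1.aSeq_one`). [cite: Balaban1982Higgs1, (2.15) p.609] -/
theorem renormTransfK_one (hL : 1 < P.L) (ρ : ScalarField P 0 N → ℝ) :
    renormTransfK C a A 1 ρ = renormTransf C a A ρ := by
  have hL' : (1 : ℝ) < P.L := by exact_mod_cast hL
  funext ψ
  rw [renormTransfK, renormTransf, rtKernelK, rtKernelStep, B1.aSeq_one hL', avgQk_one]

/-- **(2.16) for the concrete model**, KERNEL: for 1 ≤ k ≤ K, a > 0, L > 1 and every integrable density ρ(A,·), the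
k successive one-step transformations equal the k-th order transformation: verbatim p. 609 — *"Thus we get the
following formula for the composition of k successive renormalization transformations
T^{L^{k−1}ε}_{a,L,A} … T^{Lε}_{a,L,A}T^ε_{a,L,A} = T^ε_{a_k,L^k,A}. (2.16)"* (induction on k by `renormTransf_renormTransfK`).
[cite: Balaban1982Higgs1, (2.16) p.609] -/
theorem renormChain_eq_renormTransfK {a : ℝ} (ha : 0 < a) (hL : 1 < P.L) {ρ : ScalarField P 0 N → ℝ}
    (hρ : Integrable ρ) : ∀ {k : ℕ}, 1 ≤ k → k ≤ P.K → renormChain C a A k ρ = renormTransfK C a A k ρ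
  | 0, h, _ => absurd h (by omega)
  | 1, _, _ => by
      rw [renormChain, renormChain, renormTransfK_one C a A hL ρ]
  | k + 2, _, hK => by
      rw [renormChain, renormChain_eq_renormTransfK ha hL hρ (k := k + 1) (by omega) (by omega),
        renormTransf_renormTransfK C ha hL A (k := k + 1) (by omega) (by omega) hρ]

end Chain

end Literature.MathematicalPhysics.QuantumFieldTheory.Balaban1983to89.B1Eq214Concrete
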